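import Summits.ValiantsHypothesis.ValiantsHypothesis.Theorems.DivisionGapSquareGridDimersDivisionEasyGridEdges

/-!
# Positivity, and the shuffling algorithm as a layered polynomial map

(1) Positive elements of a field (quotients of images of nonzero elements of a zerosumfree semiring
without zero divisors) are closed under `+`, `*`, `/` and nonzero; crossing edges of a cell come in
opposite pairs and never two pairs at once, so a cell factor `wz + xy` whose weights vanish exactly on
crossing edges is positive (`PosSys.isPos_cf_of_xing`) — this is why Propp's caveat (2003, §9 item 1:
zero weights may make cell factors vanish) does not bite for the square grid.
(2) Carrying every weight as (numerator, denominator), one renewal round is a constant-size-per-variable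
polynomial substitution `Gsub m`, and the whole algorithm from level `m` is the polynomial `Φ m b`
(`Φ (m+1) b = bind₁ (Gsub m) (Φ m b)`); `eval_Φ` is its semantics: `Φ m true / Φ m false` evaluates to
the accumulated product of cell factors times the dimer partition function (Propp's theorem, level by
level). [cite: Propp2003, §2]

All `def … : Prop` declarations in this file are decidable predicates on finite data (not named facts).
Support file for `SquareGridDimersDivisionEasy` (route DivisionGap, item stmt-ValiantsHypothesis-5072);
the closing theorem is `squareGridDimersDivisionEasy_proof` in `…DivisionGapSquareGridDimersDivisionEasy.lean`.
-/

namespace Summit.ValiantsHypothesis.ValiantsHypothesis.Theorems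

namespace SquareGridDimers

set_option linter.dupNamespace false

noncomputable section

open Finset

/-! ## Positivity: no cell factor vanishes along the algorithm

Weights are "positive" elements of a field `F` in the image of an injective semiring map from a
zerosumfree semiring without zero divisors (for the item: `ℝ≥0`-polynomials inside the fraction field
of the real polynomials).  Positive elements are closed under `+`, `*`, `/` and are nonzero; the
weights of the square-grid Aztec diamond are `0` exactly on the edges crossing the grid boundary,
and these come in opposite pairs inside every cell, never two pairs at once (Propp 2003, §9 item 1
warns that zero weights may produce vanishing cell factors; here they do not). -/

section Positivity

variable {P F : Type*} [CommSemiring P] [Field F]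

/-- A positivity structure: an injective semiring map from a zerosumfree semiring without zero
divisors into a field. [folklore] -/
structure PosSys (P F : Type*) [CommSemiring P] [Field F] where
  /-- the embedding -/
  emb : P →+* F
  /-- injectivity of the embedding -/
  inj : Function.Injective emb
  /-- zerosumfree -/
  eq_zero_of_add_eq_zero : ∀ a b : P, a + b = 0 → a = 0
  /-- no zero divisors -/
  eq_zero_or_eq_zero_of_mul_eq_zero : ∀ a b : P, a * b = 0 → a = 0 ∨ b = 0
  /-- nontriviality -/
  one_ne_zero' : (1 : P) ≠ 0

/-- Positive elements: quotients of images of nonzero elements. [folklore] -/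
def PosSys.IsPos (S : PosSys P F) (x : F) : Prop := ∃ p q : P, p ≠ 0 ∧ q ≠ 0 ∧ x * S.emb q = S.emb p

/-- Images of nonzero elements are nonzero. [folklore] -/
theorem PosSys.emb_ne_zero (S : PosSys P F) {p : P} (hp : p ≠ 0) : S.emb p ≠ 0 := by
  intro h; exact hp (S.inj (by rw [h, map_zero]))

/-- Positive elements are nonzero. [folklore] -/
theorem PosSys.IsPos.ne_zero {S : PosSys P F} {x : F} (h : S.IsPos x) : x ≠ 0 := by
  obtain ⟨p, q, hp, -, hx⟩ := h
  intro h0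
  rw [h0, zero_mul] at hx
  exact S.emb_ne_zero hp hx.symm

/-- Images of nonzero elements are positive. [folklore] -/
theorem PosSys.isPos_emb (S : PosSys P F) {p : P} (hp : p ≠ 0) : S.IsPos (S.emb p) :=
  ⟨p, 1, hp, S.one_ne_zero', by rw [map_one, mul_one]⟩

/-- `1` is positive. [folklore] -/
theorem PosSys.isPos_one (S : PosSys P F) : S.IsPos 1 := by
  simpa using S.isPos_emb S.one_ne_zero'

/-- Products of nonzero elements are nonzero. [folklore] -/
theorem PosSys.mul_ne_zero_of (S : PosSys P F) {a b : P} (ha : a ≠ 0) (hb : b ≠ 0) : a * b ≠ 0 :=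
  fun h => (S.eq_zero_or_eq_zero_of_mul_eq_zero a b h).elim ha hb

/-- Sums of positive elements are positive. [folklore] -/
theorem PosSys.IsPos.add {S : PosSys P F} {x y : F} (hx : S.IsPos x) (hy : S.IsPos y) :
    S.IsPos (x + y) := by
  obtain ⟨p, q, hp, hq, hx⟩ := hx
  obtain ⟨p', q', hp', hq', hy⟩ := hy
  refine ⟨p * q' + p' * q, q * q', ?_, S.mul_ne_zero_of hq hq', ?_⟩
  · intro h
    exact S.mul_ne_zero_of hp hq' (S.eq_zero_of_add_eq_zero _ _ h)
  · rw [map_mul, map_add, map_mul, map_mul, ← hx, ← hy]; ring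

/-- Products of positive elements are positive. [folklore] -/
theorem PosSys.IsPos.mul {S : PosSys P F} {x y : F} (hx : S.IsPos x) (hy : S.IsPos y) :
    S.IsPos (x * y) := by
  obtain ⟨p, q, hp, hq, hx⟩ := hx
  obtain ⟨p', q', hp', hq', hy⟩ := hy
  refine ⟨p * p', q * q', S.mul_ne_zero_of hp hp', S.mul_ne_zero_of hq hq', ?_⟩
  rw [map_mul, map_mul, ← hx, ← hy]; ring

/-- Quotients of positive elements are positive. [folklore] -/
theorem PosSys.IsPos.div {S : PosSys P F} {x y : F} (hx : S.IsPos x) (hy : S.IsPos y) :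
    S.IsPos (x / y) := by
  have hy0 := hy.ne_zero
  obtain ⟨p, q, hp, hq, hx⟩ := hx
  obtain ⟨p', q', hp', hq', hy⟩ := hy
  refine ⟨p * q', q * p', S.mul_ne_zero_of hp hq', S.mul_ne_zero_of hq hp', ?_⟩
  have hq'F : S.emb q' = S.emb p' / y := by rw [← hy]; field_simp
  rw [map_mul, map_mul, hq'F, ← hx]
  field_simp

/-- Finite products of positive elements are positive. [folklore] -/
theorem PosSys.isPos_prod (S : PosSys P F) {ι' : Type*} (s : Finset ι') (f : ι' → F)
    (h : ∀ i ∈ s, S.IsPos (f i)) : S.IsPos (∏ i ∈ s, f i) := by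
  classical
  induction s using Finset.induction_on with
  | empty => simpa using S.isPos_one
  | insert a s ha ih =>
    rw [prod_insert ha]
    exact (h a (mem_insert_self a s)).mul (ih fun i hi => h i (mem_insert_of_mem hi))

/-! ### Absolute coordinates and crossing edges -/

/-- Absolute lattice coordinates of the horizontal endpoint of a level-`m` edge index. [cite: Propp2003, §1.1] -/
def absH (m : ℕ) (e : EInf) : ℤ × ℤ := (2 * (e.1.1 : ℤ) + 2 * e.2.1.val - m, 2 * (e.1.2 : ℤ) - m + 1)

/-- Absolute lattice coordinates of the vertical endpoint of a level-`m` edge index. [cite: Propp2003, §1.1] -/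
def absV (m : ℕ) (e : EInf) : ℤ × ℤ := (2 * (e.1.1 : ℤ) - m + 1, 2 * (e.1.2 : ℤ) + 2 * e.2.2.val - m)

/-- The grid region `|i+j| ≤ n`, `|i-j| ≤ n` in absolute coordinates. [cite: Propp2003, §1.2] -/
def InDia (n : ℕ) (z : ℤ × ℤ) : Prop :=
  -(n : ℤ) ≤ z.1 + z.2 ∧ z.1 + z.2 ≤ n ∧ -(n : ℤ) ≤ z.1 - z.2 ∧ z.1 - z.2 ≤ n

/-- A level-`m` edge index crosses the grid boundary: exactly one endpoint in the grid region. [folklore] -/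
def Xing (n m : ℕ) (e : EInf) : Prop := ¬ (InDia n (absH m e) ↔ InDia n (absV m e))

/-- Opposite edges of a live cell cross together. [folklore] -/
theorem xing_opp_iff {n m : ℕ} (hm : m ≤ n) (c : ℕ × ℕ) (hc : c.1 < m ∧ c.2 < m) (pos : Pos) :
    Xing n m (c, opp pos) ↔ Xing n m (c, pos) := by
  obtain ⟨δ, ε⟩ := pos
  have := δ.isLt; have := ε.isLt
  simp only [Xing, InDia, absH, absV, opp, Fin.val_rev]
  omega

/-- The two opposite pairs of a live cell never cross simultaneously. [folklore] -/
theorem not_xing_both {n m : ℕ} (hm : m ≤ n) (c : ℕ × ℕ) :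
    ¬ (Xing n m (c, (0, 1)) ∧ Xing n m (c, (1, 1))) := by
  simp only [Xing, InDia, absH, absV, Fin.val_zero, Fin.val_one]
  omega

/-- The numerator edge of a renewal step crosses iff the renewed edge does. [folklore] -/
theorem xing_num_iff {n m : ℕ} (hm : m + 1 ≤ n) (e : EInf) (he : e.1.1 < m ∧ e.1.2 < m) :
    Xing n (m + 1) ((e.1.1 + e.2.1.val, e.1.2 + e.2.2.val), e.2) ↔ Xing n m e := by
  obtain ⟨⟨p, q⟩, ⟨δ, ε⟩⟩ := e
  have := δ.isLt; have := ε.isLt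
  simp only at he
  simp only [Xing, InDia, absH, absV]
  push_cast
  omega

/-! ### Positivity of a cell factor from the crossing pattern -/

/-- **A cell factor never vanishes**: if the weights of a cell are zero exactly on its crossing
edges, crossing edges come in opposite pairs and not both pairs cross, then `wz + xy` is positive.
[folklore] -/
theorem PosSys.isPos_cf_of_xing (S : PosSys P F) {X01 X10 X11 X00 : Prop} (e1 : X10 ↔ X01)
    (e2 : X00 ↔ X11) (hnb : ¬ (X01 ∧ X11)) {w01 w10 w11 w00 : F}
    (h01 : (X01 → w01 = 0) ∧ (¬ X01 → S.IsPos w01)) (h10 : (X10 → w10 = 0) ∧ (¬ X10 → S.IsPos w10))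
    (h11 : (X11 → w11 = 0) ∧ (¬ X11 → S.IsPos w11)) (h00 : (X00 → w00 = 0) ∧ (¬ X00 → S.IsPos w00)) :
    S.IsPos (w01 * w10 + w11 * w00) := by
  by_cases hA : X01
  · have hB : ¬ X11 := fun hB => hnb ⟨hA, hB⟩
    rw [h01.1 hA, zero_mul, zero_add]
    exact (h11.2 hB).mul (h00.2 (fun h => hB (e2.mp h)))
  · by_cases hB : X11
    · rw [h11.1 hB, zero_mul, add_zero]
      exact (h01.2 hA).mul (h10.2 (fun h => hA (e1.mp h)))
    · exact ((h01.2 hA).mul (h10.2 (fun h => hA (e1.mp h)))).add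
        ((h11.2 hB).mul (h00.2 (fun h => hB (e2.mp h))))

end Positivity

/-! ## The algorithm as a layered polynomial map (numerators and denominators)

Each weight is carried as a pair (numerator, denominator); one renewal round is a polynomial
substitution `Gsub m` of constant size per variable, and the whole algorithm from level `m` down to
level `0` is the polynomial `Φ m b` (`b = true`: accumulated numerator of the product of cell factors,
`b = false`: accumulated denominator), defined by `Φ (m+1) b = bind₁ (Gsub m) (Φ m b)`; this layered
form is what makes the circuit bound `complexity_aeval_le` applicable with sharing. -/

section Layers

variable (K : Type*) [CommSemiring K]

/-- Variables of level `m`: a numerator (`true`) and a denominator (`false`) variable per edge, and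
two accumulator variables. [folklore] -/
abbrev VarL (m : ℕ) : Type := (E m × Bool) ⊕ Bool

/-- The numerator edge of the renewal step at `e'`: the opposite edge, in the level-`(m+1)` cell of
`ι e'`. [cite: Propp2003, §2] -/
def numEdge {m : ℕ} (e : E m) : E (m + 1) := ((ι e).1, opp (ι e).2)

/-- Shorthand for the variables. [folklore] -/
def xv {m : ℕ} (e : E m) (b : Bool) : MvPolynomial (VarL m) K := MvPolynomial.X (Sum.inl (e, b))

/-- Numerator of a cell factor in terms of numerator/denominator variables:
`ν_w ν_z δ_x δ_y + ν_x ν_y δ_w δ_z`. [cite: Propp2003, §2] -/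
def cfn {m : ℕ} (c : Cell m) : MvPolynomial (VarL m) K :=
  xv K (c, (0, 1)) true * xv K (c, (1, 0)) true * xv K (c, (1, 1)) false * xv K (c, (0, 0)) false +
    xv K (c, (1, 1)) true * xv K (c, (0, 0)) true * xv K (c, (0, 1)) false * xv K (c, (1, 0)) false

/-- Denominator of a cell factor: `δ_w δ_z δ_x δ_y`. [cite: Propp2003, §2] -/
def cfd {m : ℕ} (c : Cell m) : MvPolynomial (VarL m) K :=
  xv K (c, (0, 1)) false * xv K (c, (1, 0)) false * xv K (c, (1, 1)) false * xv K (c, (0, 0)) false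

/-- One renewal round as a substitution: level-`m` variables in terms of level-`(m+1)` variables.
[cite: Propp2003, §2] -/
def Gsub (m : ℕ) : VarL m → MvPolynomial (VarL (m + 1)) K
  | Sum.inl (e, true) => xv K (numEdge e) true * cfd K (numEdge e).1
  | Sum.inl (e, false) => xv K (numEdge e) false * cfn K (numEdge e).1
  | Sum.inr true => MvPolynomial.X (Sum.inr true) * ∏ c : Cell (m + 1), cfn K c
  | Sum.inr false => MvPolynomial.X (Sum.inr false) * ∏ c : Cell (m + 1), cfd K c

/-- The whole algorithm from level `m` down to `0`, as a polynomial in the level-`m` variables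
(`true`: numerator, `false`: denominator of the accumulated product of cell factors). [cite: Propp2003, §2] -/
def Φ : (m : ℕ) → Bool → MvPolynomial (VarL m) K
  | 0, b => MvPolynomial.X (Sum.inr b)
  | m + 1, b => MvPolynomial.bind₁ (Gsub K m) (Φ m b)

variable {K}
variable {F : Type*} [Field F] (φ : K →+* F)

/-- The weights encoded by a valuation of the level-`m` variables. [folklore] -/
def Ws {m : ℕ} (s : VarL m → F) (e : E m) : F := s (Sum.inl (e, true)) / s (Sum.inl (e, false))

/-- The valuation of the level-`m` variables computed from a valuation of the level-`(m+1)` ones. [folklore] -/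
def nextVal {m : ℕ} (s : VarL (m + 1) → F) : VarL m → F :=
  fun v => MvPolynomial.eval₂Hom φ s (Gsub K m v)

/-- Admissible valuations: no denominator, accumulator or cell factor vanishes along the way. [folklore] -/
def Good : (m : ℕ) → (VarL m → F) → Prop
  | 0, s => s (Sum.inr false) ≠ 0
  | m + 1, s => s (Sum.inr false) ≠ 0 ∧ (∀ e, s (Sum.inl (e, false)) ≠ 0) ∧
      (∀ c, cf (Ws s) c ≠ 0) ∧ Good m (nextVal φ s)

/-- Propp's theorem with level-indexed weights. [cite: Propp2003, §2] -/
theorem propp' {m : ℕ} (ew : E (m + 1) → F) (hcf : ∀ c, cf ew c ≠ 0) :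
    Z univ ew = (∏ c : Cell (m + 1), cf ew c) * Z (univ : Finset (V m)) (fun e => rt ew (ι e)) := by
  rw [Z_univ_eq_prod_cf_mul_Z_inner ew hcf, Z_inner_eq_Z_univ]

omit [Field F] in
/-- Evaluating the cell-factor numerator. [folklore] -/
theorem eval_cfn {F' : Type*} [CommSemiring F'] (φ' : K →+* F') {m : ℕ} (s : VarL m → F') (c : Cell m) :
    MvPolynomial.eval₂Hom φ' s (cfn K c) =
      s (Sum.inl ((c, (0, 1)), true)) * s (Sum.inl ((c, (1, 0)), true)) *
        s (Sum.inl ((c, (1, 1)), false)) * s (Sum.inl ((c, (0, 0)), false)) +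
      s (Sum.inl ((c, (1, 1)), true)) * s (Sum.inl ((c, (0, 0)), true)) *
        s (Sum.inl ((c, (0, 1)), false)) * s (Sum.inl ((c, (1, 0)), false)) := by
  simp [cfn, xv]

omit [Field F] in
/-- Evaluating the cell-factor denominator. [folklore] -/
theorem eval_cfd {F' : Type*} [CommSemiring F'] (φ' : K →+* F') {m : ℕ} (s : VarL m → F') (c : Cell m) :
    MvPolynomial.eval₂Hom φ' s (cfd K c) =
      s (Sum.inl ((c, (0, 1)), false)) * s (Sum.inl ((c, (1, 0)), false)) *
        s (Sum.inl ((c, (1, 1)), false)) * s (Sum.inl ((c, (0, 0)), false)) := by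
  simp [cfd, xv]

/-- The cell factor is the quotient of its numerator and denominator evaluations. [folklore] -/
theorem eval_cfn_eq_cf_mul {m : ℕ} (s : VarL m → F) (hs : ∀ e, s (Sum.inl (e, false)) ≠ 0) (c : Cell m) :
    MvPolynomial.eval₂Hom φ s (cfn K c) = cf (Ws s) c * MvPolynomial.eval₂Hom φ s (cfd K c) := by
  rw [eval_cfn, eval_cfd]
  simp only [cf, Ws]
  have h1 := hs (c, (0, 1)); have h2 := hs (c, (1, 0)); have h3 := hs (c, (1, 1)); have h4 := hs (c, (0, 0))
  field_simp

/-- The weights of the next valuation are the renewed weights. [folklore] -/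
theorem Ws_nextVal {m : ℕ} (s : VarL (m + 1) → F) (hs : ∀ e, s (Sum.inl (e, false)) ≠ 0)
    (hcf : ∀ c, cf (Ws s) c ≠ 0) (e : E m) : Ws (nextVal φ s) e = rt (Ws s) (ι e) := by
  simp only [Ws, nextVal, Gsub, map_mul, rt]
  rw [eval_cfn_eq_cf_mul φ s hs]
  simp only [MvPolynomial.eval₂Hom_X', xv, numEdge]
  have hd : (MvPolynomial.eval₂Hom φ s) (cfd K (ι e).1) ≠ 0 := by
    rw [eval_cfd]
    exact mul_ne_zero (mul_ne_zero (mul_ne_zero (hs _) (hs _)) (hs _)) (hs _)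
  have := hs ((ι e).1, opp (ι e).2)
  have := hcf (ι e).1
  field_simp

/-- **Semantics of the layered polynomials.** For an admissible valuation, `Φ m false` does not
vanish and `Φ m true / Φ m false` evaluates to the accumulator ratio times the dimer partition
function of the encoded weights. [cite: Propp2003, §2] -/
theorem eval_Φ (m : ℕ) : ∀ s : VarL m → F, Good φ m s →
    MvPolynomial.eval₂Hom φ s (Φ K m false) ≠ 0 ∧
      MvPolynomial.eval₂Hom φ s (Φ K m true) / MvPolynomial.eval₂Hom φ s (Φ K m false) =
        s (Sum.inr true) / s (Sum.inr false) * Z univ (Ws s) := by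
  induction m with
  | zero =>
    intro s hs
    have hs' : s (Sum.inr false) ≠ 0 := hs
    refine ⟨by simpa [Φ] using hs', ?_⟩
    have hz : Z (univ : Finset (V 0)) (Ws s) = 1 := Z_univ_zero _
    simp only [Φ, MvPolynomial.eval₂Hom_X']
    rw [hz, mul_one]
  | succ m ih =>
    intro s hs
    obtain ⟨hF, hden, hcf, hgood⟩ := hs
    have step : ∀ b, MvPolynomial.eval₂Hom φ s (Φ K (m + 1) b) =
        MvPolynomial.eval₂Hom φ (nextVal φ s) (Φ K m b) := fun b => by
      simp only [Φ, MvPolynomial.eval₂Hom_bind₁]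
      rfl
    obtain ⟨ih1, ih2⟩ := ih (nextVal φ s) hgood
    rw [step, step]
    refine ⟨ih1, ?_⟩
    rw [ih2, propp' (Ws s) hcf]
    have hT : nextVal φ s (Sum.inr true) = s (Sum.inr true) * ∏ c, MvPolynomial.eval₂Hom φ s (cfn K c) := by
      simp [nextVal, Gsub]
    have hF' : nextVal φ s (Sum.inr false) = s (Sum.inr false) * ∏ c, MvPolynomial.eval₂Hom φ s (cfd K c) := by
      simp [nextVal, Gsub]
    have hW : Ws (nextVal φ s) = fun e => rt (Ws s) (ι e) := funext (Ws_nextVal φ s hden hcf)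
    rw [hT, hF', hW]
    simp only [eval_cfn_eq_cf_mul φ s hden, prod_mul_distrib]
    have hd : ∏ c : Cell (m + 1), MvPolynomial.eval₂Hom φ s (cfd K c) ≠ 0 := by
      refine prod_ne_zero_iff.mpr fun c _ => ?_
      rw [eval_cfd]
      exact mul_ne_zero (mul_ne_zero (mul_ne_zero (hden _) (hden _)) (hden _)) (hden _)
    field_simp

end Layers

end

end SquareGridDimers

end Summit.ValiantsHypothesis.ValiantsHypothesis.Theorems
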